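import Summits.Ventures.KdS.RouteWFermionicRealAxis
import Literature.Geometry.Lorentzian.KerrDeSitterRadialTSRealAxisAbsThreeHalves
import HarnessLib

/-!
# Venture KdS — the fermionic real-axis clause at `|s| = 3/2`, fact-free: the Teukolsky–Starobinsky-
# coercive part of Casals–Teixeira da Costa's Theorem 3.10 at `|s| = 3/2` is a THEOREM of the tree,
# and Theorem 3.10 with EVERY fermionic escape restricted to its coercive region (VARIANT C)

HONEST FRAMING (venture `Summits/Ventures/KdS`, cell `pub-kds`, seat P1 g10 under lead rulings A116
ext. 2/4/5). Nothing here is a claim about the Final State Conjecture or about nonlinear stability,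
and nothing here touches the census records, the window constants or the tables. This file rebinds
LANDED Literature theorems (0 facts):

* `KerrDeSitter.radial_real_eq_zero_of_fermionicTSCoerciveThreeHalves`
  (`KerrDeSitterRadialTSRealAxisThreeHalves.lean`, the `s = 3/2` energy identity),
  `KerrDeSitter.radial_real_eq_zero_of_fermionicTSCoerciveNegThreeHalves`
  (`KerrDeSitterRadialTSRealAxisNegThreeHalves.lean`, `s = −3/2` by duality) and their union
  `KerrDeSitter.radial_real_eq_zero_of_fermionicTSCoerciveAbsThreeHalves`
  (`KerrDeSitterRadialTSRealAxisAbsThreeHalves.lean`): for `2|s| = 3`, `Im ω = 0`, `Im λ̄ = 0`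
  and `Re ℭ_{3/2}(λ̄) ≥ 0` (Wu–Yan's `|C_{3/2}|²`, `tsRadialConstantThreeHalves`), every
  generic-boundary radial Teukolsky solution vanishes, with NO window, rotation, `m` or `ω ≠ 0`
  condition;

into:

* `RouteW.fermionicRealAxis_coercive_threeHalves` / `_negThreeHalves` / `_absThreeHalves` — the
  `|s| = 3/2` COERCIVE part of the residual hypothesis `hF` of
  `RouteW.theorem310_of_fermionicRealAxis`, PROVED, in the binder shape of
  `RouteW.fermionicRealAxis_coercive_half`;
* `RouteW.theorem310_tsCoerciveAll` — **Theorem 3.10 (with Definition 3.4's `ω ≠ 0`),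
  generic-boundary regime, with the fermionic escape of the real-axis bullet restricted to
  `(|s| = 1/2 ∧ ℭ_{1/2}(λ̄) ≥ 0) ∨ (|s| = 3/2 ∧ Re ℭ_{3/2}(λ̄) ≥ 0)` (VARIANT C) — PROVED, 0 cited
  facts, 0 open hypotheses** (VARIANT B `RouteW.theorem310_tsCoercive` plus the `|s| = 3/2`
  clause);
* `RouteW.theorem310_of_fermionicNoncoerciveAll` — what is left of
  `CasalsTeixeiraDaCosta2022_theorem310` AS PRINTED after this file: only the NON-coercive fermionic
  clauses (`|s| = 1/2` with `Re ℭ_{1/2}(λ̄) < 0`, or `|s| = 3/2` with `Re ℭ_{3/2}(λ̄) < 0`; real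
  `ω ≠ 0`, real `λ̄`, no window condition) imply the fact. Those clauses are asserted nowhere; at
  `|s| = 1/2` the printed clause is refuted by the cell's certified solution (P-014, see
  `RouteWFermionicRealAxis.lean`), and the cell's certified real-frequency `s = 3/2` solutions
  (P-020/P-022) all have `Re ℭ_{3/2}(λ̄) < 0`.

References: [CasalsTeixeiradacosta2022] Theorem 3.10 (second bullet, `|s| = 3/2`), Definition 3.4,
p. 17; [Costa2019] Prop. 2.21; [WuYan2004] Appendix A (A4)–(A6).
-/

noncomputable section

open Set Complex

namespace Summit.Ventures.KdS

namespace RouteW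

open Literature.Geometry.Lorentzian Literature.Geometry.Lorentzian.KerrDeSitter

/-! ### The coercive `|s| = 3/2` parts of the fermionic residual, proved -/

/-- **The `s = +3/2` coercive part of the fermionic residual — PROVED, 0 facts.** The binders of
`fermionicRealAxis_coercive_half` with the clause `FermionicTSCoerciveThreeHalves` in place of
`FermionicTSCoercive`: subextremal, `Im ω = 0`, `Im λ̄ = 0`, a generic-boundary radial solution ⟹
`R ≡ 0` on `(r₊, r_c)`. The binders `0 ≤ a`, `ω ≠ 0` and the regime disjunctions are not used.
[cite: CasalsTeixeiradacosta2022, Theorem 3.10 (second bullet, |s| = 3/2) with Costa2019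
Proposition 2.21] -/
theorem fermionicRealAxis_coercive_threeHalves (M a Λ s : ℝ) (ω : ℂ) (m : ℝ) (lam : ℂ)
    (hsub : IsSubextremal M a Λ) (_ha : 0 ≤ a) (hF : FermionicTSCoerciveThreeHalves M a Λ s ω m lam)
    (_hω0 : ω ≠ 0) (hω : ω.im = 0) (hlam : (lambdaBar a Λ s ω m lam).im = 0)
    (_h1 : ω.re ≠ m * horizonAngVel a (rPlus M a Λ) ∨ s ≤ 0)
    (_h2 : ω.re ≠ m * horizonAngVel a (rCosmo M a Λ) ∨ 0 ≤ s)
    (R : ℝ → ℂ) (hR : IsRadialTeukolskySolution M a Λ s ω m lam R)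
    (hin : IsIngoingAtEventHorizon M a Λ s ω m R) (hout : IsOutgoingAtCosmoHorizon M a Λ ω m R) :
    ∀ r ∈ Ioo (rPlus M a Λ) (rCosmo M a Λ), R r = 0 :=
  radial_real_eq_zero_of_fermionicTSCoerciveThreeHalves hsub hω hlam hF hR hin hout

/-- **The `s = −3/2` coercive part of the fermionic residual — PROVED, 0 facts** (by duality from
the `s = +3/2` machinery). The binders of `fermionicRealAxis_coercive_half` with the clause
`FermionicTSCoerciveNegThreeHalves`. [cite: CasalsTeixeiradacosta2022, Theorem 3.10 (second
bullet, |s| = 3/2) with Costa2019 Proposition 2.21 and WuYan2004 Appendix A (A4)] -/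
theorem fermionicRealAxis_coercive_negThreeHalves (M a Λ s : ℝ) (ω : ℂ) (m : ℝ) (lam : ℂ)
    (hsub : IsSubextremal M a Λ) (_ha : 0 ≤ a)
    (hF : FermionicTSCoerciveNegThreeHalves M a Λ s ω m lam)
    (_hω0 : ω ≠ 0) (hω : ω.im = 0) (hlam : (lambdaBar a Λ s ω m lam).im = 0)
    (_h1 : ω.re ≠ m * horizonAngVel a (rPlus M a Λ) ∨ s ≤ 0)
    (_h2 : ω.re ≠ m * horizonAngVel a (rCosmo M a Λ) ∨ 0 ≤ s)
    (R : ℝ → ℂ) (hR : IsRadialTeukolskySolution M a Λ s ω m lam R)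
    (hin : IsIngoingAtEventHorizon M a Λ s ω m R) (hout : IsOutgoingAtCosmoHorizon M a Λ ω m R) :
    ∀ r ∈ Ioo (rPlus M a Λ) (rCosmo M a Λ), R r = 0 :=
  radial_real_eq_zero_of_fermionicTSCoerciveNegThreeHalves hsub hω hlam hF hR hin hout

/-- **The `|s| = 3/2` coercive part of the fermionic residual, both signs — PROVED, 0 facts.** The
binders of `fermionicRealAxis_coercive_half` with the clause `FermionicTSCoerciveAbsThreeHalves`
(`2|s| = 3 ∧ Re ℭ_{3/2}(λ̄) ≥ 0`). [cite: CasalsTeixeiradacosta2022, Theorem 3.10 (second bullet,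
|s| = 3/2) with Costa2019 Proposition 2.21] -/
theorem fermionicRealAxis_coercive_absThreeHalves (M a Λ s : ℝ) (ω : ℂ) (m : ℝ) (lam : ℂ)
    (hsub : IsSubextremal M a Λ) (_ha : 0 ≤ a)
    (hF : FermionicTSCoerciveAbsThreeHalves M a Λ s ω m lam)
    (_hω0 : ω ≠ 0) (hω : ω.im = 0) (hlam : (lambdaBar a Λ s ω m lam).im = 0)
    (_h1 : ω.re ≠ m * horizonAngVel a (rPlus M a Λ) ∨ s ≤ 0)
    (_h2 : ω.re ≠ m * horizonAngVel a (rCosmo M a Λ) ∨ 0 ≤ s)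
    (R : ℝ → ℂ) (hR : IsRadialTeukolskySolution M a Λ s ω m lam R)
    (hin : IsIngoingAtEventHorizon M a Λ s ω m R) (hout : IsOutgoingAtCosmoHorizon M a Λ ω m R) :
    ∀ r ∈ Ioo (rPlus M a Λ) (rCosmo M a Λ), R r = 0 :=
  radial_real_eq_zero_of_fermionicTSCoerciveAbsThreeHalves hsub hω hlam hF hR hin hout

/-! ### Theorem 3.10 with every fermionic escape restricted to its coercive region (VARIANT C) -/

/-- **CTdC Theorem 3.10 (with Definition 3.4's `ω ≠ 0`), generic-boundary regime, fermionic
real-axis escape restricted to `(|s| = 1/2 ∧ ℭ_{1/2}(λ̄) ≥ 0) ∨ (|s| = 3/2 ∧ Re ℭ_{3/2}(λ̄) ≥ 0)`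
(VARIANT C) — PROVED for every `s ∈ ½ℤ`, 0 cited facts, 0 open hypotheses.** Literally the binder
list of `theorem310_tsCoercive` (VARIANT B) with the escape `FermionicTSCoercive M a Λ s ω m lam`
widened to `FermionicTSCoercive … ∨ FermionicTSCoerciveAbsThreeHalves …`.
[cite: CasalsTeixeiradacosta2022, Theorem 3.10 with Definition 3.4; fermionic clauses per
Costa2019, Proposition 2.21] -/
theorem theorem310_tsCoerciveAll (M a Λ s : ℝ) (ω : ℂ) (m : ℝ) (lam : ℂ)
    (hsub : IsSubextremal M a Λ) (ha : 0 ≤ a) (_haL : |a| < 3 / Λ) (_haL2 : a ^ 2 < 3 / Λ)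
    (h2s : ∃ k : ℤ, 2 * s = k) (_hm : ∃ k : ℤ, m - s = k) (hω0 : ω ≠ 0)
    (hb : (0 < ω.im ∧ (lambdaBar a Λ s ω m lam * (starRingEnd ℂ) ω).im ≤ 0 ∧
        ¬(0 < ‖ω‖ ∧ ‖ω‖ < |m| * superradiantUpper M a Λ)) ∨
      (ω.im = 0 ∧ (lambdaBar a Λ s ω m lam).im = 0 ∧
        ((FermionicTSCoercive M a Λ s ω m lam ∨ FermionicTSCoerciveAbsThreeHalves M a Λ s ω m lam) ∨
          m = 0 ∨
          ¬(superradiantLower M a Λ < ω.re / m ∧ ω.re / m < superradiantUpper M a Λ))))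
    (h1 : ω.re ≠ m * horizonAngVel a (rPlus M a Λ) ∨ s ≤ 0)
    (_h2 : ω.re ≠ m * horizonAngVel a (rCosmo M a Λ) ∨ 0 ≤ s)
    (R : ℝ → ℂ) (hR : IsRadialTeukolskySolution M a Λ s ω m lam R)
    (hin : IsIngoingAtEventHorizon M a Λ s ω m R) (hout : IsOutgoingAtCosmoHorizon M a Λ ω m R) :
    ∀ r ∈ Ioo (rPlus M a Λ) (rCosmo M a Λ), R r = 0 := by
  rcases hb with ⟨hωi, hlam, hSR⟩ | ⟨hωi, hlam, hsr⟩
  · exact theorem310_bullet1 hsub ha h2s hωi hlam hSR h1 hR hin hout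
  · rcases hsr with (hF | hF) | hm0 | hwin
    · exact radial_real_eq_zero_of_fermionicTSCoercive hsub hωi hlam hF hR hin hout
    · exact radial_real_eq_zero_of_fermionicTSCoerciveAbsThreeHalves hsub hωi hlam hF hR hin hout
    · exact realAxis_vanishing_allSpins hsub ha h2s hωi hω0 hlam (Or.inl hm0) h1 hR hin hout
    · exact realAxis_vanishing_allSpins hsub ha h2s hωi hω0 hlam (Or.inr hwin) h1 hR hin hout

/-! ### What is left of the fact AS PRINTED: only the non-coercive fermionic clauses -/

/-- **The residual of `CasalsTeixeiraDaCosta2022_theorem310_holds` after this file, typed as an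
implication (no new fact).** IF the NON-coercive fermionic clauses held — `|s| = 1/2` with
`Re ℭ_{1/2}(λ̄) < 0`, or `|s| = 3/2` with `Re ℭ_{3/2}(λ̄) < 0`; `ω ∈ ℝ∖{0}`, `Im λ̄ = 0`, generic
regime, no window condition ⟹ `R ≡ 0` — THEN the cited fact `CasalsTeixeiraDaCosta2022_theorem310`
would hold outright (the coercive parts being `fermionicRealAxis_coercive_half` and
`fermionicRealAxis_coercive_absThreeHalves`). The hypothesis is asserted nowhere in the tree.
[cite: CasalsTeixeiradacosta2022, Theorem 3.10 (second bullet, |s| = 1/2, 3/2)] -/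
theorem theorem310_of_fermionicNoncoerciveAll
    (hN : ∀ (M a Λ s : ℝ) (ω : ℂ) (m : ℝ) (lam : ℂ), IsSubextremal M a Λ → 0 ≤ a →
      ((2 * |s| = 1 ∧ (tsRadialConstantHalf a Λ ω m (lambdaBar a Λ s ω m lam)).re < 0) ∨
        (2 * |s| = 3 ∧
          (tsRadialConstantThreeHalves M a Λ ω m (lambdaBar a Λ s ω m lam)).re < 0)) →
      ω ≠ 0 → ω.im = 0 → (lambdaBar a Λ s ω m lam).im = 0 →
      (ω.re ≠ m * horizonAngVel a (rPlus M a Λ) ∨ s ≤ 0) →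
      (ω.re ≠ m * horizonAngVel a (rCosmo M a Λ) ∨ 0 ≤ s) →
      ∀ R : ℝ → ℂ, IsRadialTeukolskySolution M a Λ s ω m lam R →
        IsIngoingAtEventHorizon M a Λ s ω m R → IsOutgoingAtCosmoHorizon M a Λ ω m R →
          ∀ r ∈ Ioo (rPlus M a Λ) (rCosmo M a Λ), R r = 0) :
    CasalsTeixeiraDaCosta2022_theorem310 := by
  refine theorem310_of_fermionicNoncoercive ?_
  intro M a Λ s ω m lam hsub ha hferm hω0 hω hlam h1 h2 R hR hin hout
  rcases hferm with h1half | hk3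
  · exact hN M a Λ s ω m lam hsub ha (Or.inl h1half) hω0 hω hlam h1 h2 R hR hin hout
  · by_cases hc : 0 ≤ (tsRadialConstantThreeHalves M a Λ ω m (lambdaBar a Λ s ω m lam)).re
    · exact fermionicRealAxis_coercive_absThreeHalves M a Λ s ω m lam hsub ha ⟨hk3, hc⟩ hω0 hω
        hlam h1 h2 R hR hin hout
    · exact hN M a Λ s ω m lam hsub ha (Or.inr ⟨hk3, lt_of_not_ge hc⟩) hω0 hω hlam h1 h2 R hR hin
        hout

end RouteW

end Summit.Ventures.KdS

end
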